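/-
VALUE = THEOREM, NOT summit progress (cell b2b-lgcu-borel, gen 21); crux 14079 untouched.
-/
import Mathlib
import Summits.MatrixMultiplication.MatrixMultiplication.Theorems.SubgroupIdentityDesigns.Negative.AdmissibilityPrinciple

/-!
# The admissibility principle for FACTORED subgroups (`K ∖ 1 ⊆ H₁ H₂ H₃`)

VALUE = THEOREM (valid for every `p`, every `m`, every `ε`), NOT summit progress.

`AdmissibilityPrinciple.lean` (gen 21): if a member `Hᵢ` of a triple carrying a level-one identity
design contains `K`, then every non-trivial linear character `σ` of `K` has an ADMISSIBLE vector.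
The only property of `K ≤ Hᵢ` used there is that the design's test function `f` (`f ∈ F₁`,
`f(1) = 1`, `f(abc) = 0` for `abc ≠ 1`) restricts to a delta on `K`.  That holds as soon as every
`k ∈ K ∖ 1` is SOME triple product `a b c` (`a ∈ H₁, b ∈ H₂, c ∈ H₃`) — `K` may be spread over the
three members.  Hence (`cover_exists_mem_adm`, `no_design_of_cover`, `no_design_of_cover_fix`):

**FACTORED ADMISSIBILITY.**  If `K ∖ 1 ⊆ H₁ H₂ H₃` and some non-trivial linear character of `K`
has no admissible vector (equivalently: the `σ`-twisted fixed spaces `{Fix k : σ k ≠ 1}` cover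
`𝔽_p^m`), then `(H₁, H₂, H₃)` carries no level-one identity design — no TPP, no volume hypothesis.

So a linearly detected NON-CARRIER `K` can be neither contained in a member NOR FACTORED across
the members: `K ≠ A·B·C` for subgroups (or subsets) `A ⊆ H₁, B ⊆ H₂, C ⊆ H₃` (`cover_of_mul₁₂₃`,
`cover_of_mul₁₂/₁₃/₂₃`).  Instances: the root chain `U₃ = X_{ij} X_{ik} X_{jk}` (`RootChain.lean`);
semidirect products `K = N ⋊ Q` with `N` in one member and `Q` in another.  For the latter the
criterion `fix_cover_of_translate` is convenient: if ONE `q ∈ K` with `σ q ≠ 1` moves every vector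
the way some element of `ker σ` does (`q u = n_u u`), then `n_u⁻¹ q` is a `σ`-non-trivial fixer of
`u`, so no vector is admissible.  Example (paper-level here; GAP-verified: kit job j146070, ORACLE-g21
§G21-17): the Singer–Frobenius groups `N_b ⋊ ⟨φ⟩ ≤ ΓL₁(𝔽_{p^m}) ≤ GL_m(𝔽_p)` (`N_b` the norm-one
Singer subgroup of order `b = (p^m-1)/(p-1)`, `φ` the Frobenius; `φ x = x^{1-p} · x` with
`N(x^{1-p}) = 1`), so the norm-one Singer group in one member and its Frobenius in another member
is excluded.

HONEST SCOPE.  A repackaging of the principle plus bookkeeping lemmas; excludes configurations, no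
`(p,m,ε)` cell is emptied.
-/

set_option linter.dupNamespace false

noncomputable section

open scoped BigOperators Classical Matrix

namespace Summit.MatrixMultiplication.MatrixMultiplication.Theorems.SubgroupIdentityDesigns.Negative
namespace FactoredAdmissibility

open Summit.MatrixMultiplication.MatrixMultiplication.Theorems.LieRankDesigns.Negative (GLm Mat)
open PackingBridge (exists_test)
open LevelOneEquivariantDim (adm mem_adm AdmOrb)
open AdmissibilityPrinciple (exists_mem_adm one_le_card_admOrb not_mem_adm_of_cover)

variable {p m : ℕ} [hp : Fact p.Prime]

section Cover

variable {H₁ H₂ H₃ K : Subgroup (GLm p m)}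

omit hp in
/-- If `K ∖ 1 ⊆ H₁ H₂ H₃` then a test function vanishing on the non-trivial triple products is a
delta on `K`. -/
theorem vanish_of_cover {f : GLm p m → ℂ}
    (h0 : ∀ a ∈ H₁, ∀ b ∈ H₂, ∀ c ∈ H₃, a * b * c ≠ 1 → f (a * b * c) = 0)
    (hcov : ∀ k ∈ K, k ≠ 1 → ∃ a ∈ H₁, ∃ b ∈ H₂, ∃ c ∈ H₃, a * b * c = k) :
    ∀ k : K, (k : GLm p m) ≠ 1 → f k = 0 := by
  intro k hk
  obtain ⟨a, ha, b, hb, c, hc, habc⟩ := hcov k k.2 hk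
  rw [← habc]
  exact h0 a ha b hb c hc (by rw [habc]; exact hk)

/-- **FACTORED ADMISSIBILITY PRINCIPLE.**  If `K ∖ 1 ⊆ H₁ H₂ H₃` and `(H₁,H₂,H₃)` carries a
level-one identity design, every non-trivial linear character of `K` has an admissible vector. -/
theorem cover_exists_mem_adm
    (hcov : ∀ k ∈ K, k ≠ 1 → ∃ a ∈ H₁, ∃ b ∈ H₂, ∃ c ∈ H₃, a * b * c = k)
    (hdes : ∃ c : Mat p m → ℂ, (∀ M, 1 < M.rank → c M = 0) ∧
      (∑ M, c M * ZMod.stdAddChar (Matrix.trace (M * ((1 : GLm p m) : Mat p m)))) = 1 ∧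
      ∀ a ∈ H₁, ∀ b ∈ H₂, ∀ g ∈ H₃, a * b * g ≠ 1 →
        (∑ M, c M * ZMod.stdAddChar (Matrix.trace (M * ((a * b * g : GLm p m) : Mat p m)))) = 0)
    {σ : K →* ℂˣ} (hσ : σ ≠ 1) : ∃ u : Fin m → ZMod p, u ∈ adm K σ := by
  obtain ⟨f, hf, h1, h0⟩ := exists_test hdes
  exact exists_mem_adm hσ hf h1 (vanish_of_cover h0 hcov)

/-- Quantitative form: `ν_σ(K) ≥ 1` for factored `K`. -/
theorem cover_one_le_card_admOrb
    (hcov : ∀ k ∈ K, k ≠ 1 → ∃ a ∈ H₁, ∃ b ∈ H₂, ∃ c ∈ H₃, a * b * c = k)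
    (hdes : ∃ c : Mat p m → ℂ, (∀ M, 1 < M.rank → c M = 0) ∧
      (∑ M, c M * ZMod.stdAddChar (Matrix.trace (M * ((1 : GLm p m) : Mat p m)))) = 1 ∧
      ∀ a ∈ H₁, ∀ b ∈ H₂, ∀ g ∈ H₃, a * b * g ≠ 1 →
        (∑ M, c M * ZMod.stdAddChar (Matrix.trace (M * ((a * b * g : GLm p m) : Mat p m)))) = 0)
    {σ : K →* ℂˣ} (hσ : σ ≠ 1) : 1 ≤ Nat.card (AdmOrb K σ) := by
  obtain ⟨f, hf, h1, h0⟩ := exists_test hdes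
  exact one_le_card_admOrb hσ hf h1 (vanish_of_cover h0 hcov)

/-- **FACTORED EXCLUSION.**  `K ∖ 1 ⊆ H₁ H₂ H₃` and a non-trivial linear character of `K`
without admissible vectors exclude a level-one identity design. -/
theorem no_design_of_cover
    (hcov : ∀ k ∈ K, k ≠ 1 → ∃ a ∈ H₁, ∃ b ∈ H₂, ∃ c ∈ H₃, a * b * c = k)
    (σ : K →* ℂˣ) (hσ : σ ≠ 1) (hadm : ∀ u : Fin m → ZMod p, u ∉ adm K σ) :
    ¬ ∃ c : Mat p m → ℂ, (∀ M, 1 < M.rank → c M = 0) ∧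
      (∑ M, c M * ZMod.stdAddChar (Matrix.trace (M * ((1 : GLm p m) : Mat p m)))) = 1 ∧
      ∀ a ∈ H₁, ∀ b ∈ H₂, ∀ g ∈ H₃, a * b * g ≠ 1 →
        (∑ M, c M * ZMod.stdAddChar (Matrix.trace (M * ((a * b * g : GLm p m) : Mat p m)))) = 0 :=
  fun hdes => by
    obtain ⟨u, hu⟩ := cover_exists_mem_adm hcov hdes hσ
    exact hadm u hu

/-- **FACTORED EXCLUSION, fixed-space form.**  `K ∖ 1 ⊆ H₁ H₂ H₃` and: every vector is fixed
by some `k ∈ K` with `σ k ≠ 1`.  Then no level-one identity design. -/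
theorem no_design_of_cover_fix
    (hcov : ∀ k ∈ K, k ≠ 1 → ∃ a ∈ H₁, ∃ b ∈ H₂, ∃ c ∈ H₃, a * b * c = k)
    {σ : K →* ℂˣ} (hfix : ∀ u : Fin m → ZMod p, ∃ k : K, k • u = u ∧ σ k ≠ 1) :
    ¬ ∃ c : Mat p m → ℂ, (∀ M, 1 < M.rank → c M = 0) ∧
      (∑ M, c M * ZMod.stdAddChar (Matrix.trace (M * ((1 : GLm p m) : Mat p m)))) = 1 ∧
      ∀ a ∈ H₁, ∀ b ∈ H₂, ∀ g ∈ H₃, a * b * g ≠ 1 →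
        (∑ M, c M * ZMod.stdAddChar (Matrix.trace (M * ((a * b * g : GLm p m) : Mat p m)))) = 0 := by
  have hσ : σ ≠ 1 := by
    obtain ⟨k, -, hk⟩ := hfix 0
    rintro rfl
    exact hk (MonoidHom.one_apply k)
  exact no_design_of_cover hcov σ hσ (fun u => not_mem_adm_of_cover hfix u)

end Cover

/-! ## Producing the fixed-space cover: the translated-fixer criterion -/

section Translate

variable {K : Subgroup (GLm p m)}

/-- **TRANSLATED FIXER.**  If one `q ∈ K` with `σ q ≠ 1` acts on every vector like some element
of `ker σ` (`q u = n u`, `σ n = 1`), then every vector has a `σ`-non-trivial fixer (`n⁻¹ q`);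
e.g. `K = N ⋊ ⟨q⟩` with `σ` trivial on `N` and every `⟨q⟩N`-orbit an `N`-orbit. -/
theorem fix_cover_of_translate {σ : K →* ℂˣ} (q : K) (hq : σ q ≠ 1)
    (htr : ∀ u : Fin m → ZMod p, ∃ n : K, σ n = 1 ∧ q • u = n • u) :
    ∀ u : Fin m → ZMod p, ∃ k : K, k • u = u ∧ σ k ≠ 1 := by
  intro u
  obtain ⟨n, hn, hqn⟩ := htr u
  refine ⟨n⁻¹ * q, ?_, ?_⟩
  · rw [mul_smul, hqn, ← mul_smul, inv_mul_cancel, one_smul]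
  · rw [map_mul, map_inv, hn, inv_one, one_mul]
    exact hq

end Translate

/-! ## Producing the cover `K ∖ 1 ⊆ H₁ H₂ H₃` from factorisations -/

section Factor

variable {H₁ H₂ H₃ K : Subgroup (GLm p m)}

omit hp in
/-- `K ⊆ A·B·C` with `A ⊆ H₁`, `B ⊆ H₂`, `C ⊆ H₃`. -/
theorem cover_of_mul₁₂₃ {A B C : Set (GLm p m)} (hA : A ⊆ H₁) (hB : B ⊆ H₂) (hC : C ⊆ H₃)
    (hfac : ∀ k ∈ K, ∃ a ∈ A, ∃ b ∈ B, ∃ c ∈ C, a * b * c = k) :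
    ∀ k ∈ K, k ≠ 1 → ∃ a ∈ H₁, ∃ b ∈ H₂, ∃ c ∈ H₃, a * b * c = k := by
  intro k hk _
  obtain ⟨a, ha, b, hb, c, hc, h⟩ := hfac k hk
  exact ⟨a, hA ha, b, hB hb, c, hC hc, h⟩

omit hp in
/-- `K ⊆ A·B` with `A ⊆ H₁`, `B ⊆ H₂`. -/
theorem cover_of_mul₁₂ {A B : Set (GLm p m)} (hA : A ⊆ H₁) (hB : B ⊆ H₂)
    (hfac : ∀ k ∈ K, ∃ a ∈ A, ∃ b ∈ B, a * b = k) :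
    ∀ k ∈ K, k ≠ 1 → ∃ a ∈ H₁, ∃ b ∈ H₂, ∃ c ∈ H₃, a * b * c = k := by
  intro k hk _
  obtain ⟨a, ha, b, hb, h⟩ := hfac k hk
  exact ⟨a, hA ha, b, hB hb, 1, H₃.one_mem, by rw [mul_one, h]⟩

omit hp in
/-- `K ⊆ A·C` with `A ⊆ H₁`, `C ⊆ H₃`. -/
theorem cover_of_mul₁₃ {A C : Set (GLm p m)} (hA : A ⊆ H₁) (hC : C ⊆ H₃)
    (hfac : ∀ k ∈ K, ∃ a ∈ A, ∃ c ∈ C, a * c = k) :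
    ∀ k ∈ K, k ≠ 1 → ∃ a ∈ H₁, ∃ b ∈ H₂, ∃ c ∈ H₃, a * b * c = k := by
  intro k hk _
  obtain ⟨a, ha, c, hc, h⟩ := hfac k hk
  exact ⟨a, hA ha, 1, H₂.one_mem, c, hC hc, by rw [mul_one, h]⟩

omit hp in
/-- `K ⊆ B·C` with `B ⊆ H₂`, `C ⊆ H₃`. -/
theorem cover_of_mul₂₃ {B C : Set (GLm p m)} (hB : B ⊆ H₂) (hC : C ⊆ H₃)
    (hfac : ∀ k ∈ K, ∃ b ∈ B, ∃ c ∈ C, b * c = k) :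
    ∀ k ∈ K, k ≠ 1 → ∃ a ∈ H₁, ∃ b ∈ H₂, ∃ c ∈ H₃, a * b * c = k := by
  intro k hk _
  obtain ⟨b, hb, c, hc, h⟩ := hfac k hk
  exact ⟨1, H₁.one_mem, b, hB hb, c, hC hc, by rw [one_mul, h]⟩

omit hp in
/-- A semidirect-type factorisation `K = N·Q = Q·N` (as sets) gives both orders, so `N` and `Q`
may sit in any two distinct members: here `N ⊆ H₂`, `Q ⊆ H₁` from `K ⊆ Q·N`. -/
theorem cover_of_mul₂₁ {N Q : Set (GLm p m)} (hN : N ⊆ H₂) (hQ : Q ⊆ H₁)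
    (hfac : ∀ k ∈ K, ∃ q ∈ Q, ∃ n ∈ N, q * n = k) :
    ∀ k ∈ K, k ≠ 1 → ∃ a ∈ H₁, ∃ b ∈ H₂, ∃ c ∈ H₃, a * b * c = k :=
  cover_of_mul₁₂ hQ hN hfac

end Factor

/-! ## The single-member principle is the case `K ≤ Hᵢ` -/

section Member

variable {H₁ H₂ H₃ K : Subgroup (GLm p m)}

omit hp in
/-- `K ≤ H₁` is a (trivial) factorisation. -/
theorem cover_of_le₁ (h : K ≤ H₁) :
    ∀ k ∈ K, k ≠ 1 → ∃ a ∈ H₁, ∃ b ∈ H₂, ∃ c ∈ H₃, a * b * c = k :=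
  fun k hk _ => ⟨k, h hk, 1, H₂.one_mem, 1, H₃.one_mem, by rw [mul_one, mul_one]⟩

omit hp in
/-- `K ≤ H₂` is a (trivial) factorisation. -/
theorem cover_of_le₂ (h : K ≤ H₂) :
    ∀ k ∈ K, k ≠ 1 → ∃ a ∈ H₁, ∃ b ∈ H₂, ∃ c ∈ H₃, a * b * c = k :=
  fun k hk _ => ⟨1, H₁.one_mem, k, h hk, 1, H₃.one_mem, by rw [one_mul, mul_one]⟩

omit hp in
/-- `K ≤ H₃` is a (trivial) factorisation. -/
theorem cover_of_le₃ (h : K ≤ H₃) :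
    ∀ k ∈ K, k ≠ 1 → ∃ a ∈ H₁, ∃ b ∈ H₂, ∃ c ∈ H₃, a * b * c = k :=
  fun k hk _ => ⟨1, H₁.one_mem, 1, H₂.one_mem, k, h hk, by rw [one_mul, one_mul]⟩

end Member

end FactoredAdmissibility
end Summit.MatrixMultiplication.MatrixMultiplication.Theorems.SubgroupIdentityDesigns.Negative
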